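import Summits.QuantumFields.YangMills.Theorems.BalabanUVNodesN15KingModelBoxOperator
import Summits.QuantumFields.YangMills.Theorems.BalabanUVNodesN15KingModelGriffithsFiniteEtaStrict
import HarnessLib

/-!
# BalabanUVNodes ∕ N15 — THE KING-MODEL RUNG (PART Ν-a′, v1.1 doc-only erratum): THE MULTIPLE REFLECTION REPRESENTATION AT `A = 0` IN ALL `d+1` DIRECTIONS,
# DOUBLED-TORUS FORM —
# THE FREE-BOUNDARY COVARIANCE OF THE BOX `Ω = Π_μ{0,…,n_μ−1}` IS THE `2^{d+1}`-IMAGE SUM OF KING's TORUS COVARIANCE OF THE DOUBLED TORUS: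
# `(c(−Δ_free)+m²)⁻¹(s,t) = Σ_{S ⊆ {0,…,d}} (c(−Δ)+m²)⁻¹_{T(2n)}(s, σ_S t)`; positivity, the direct term as a lower bound, the sum rule `Σ_t G^{Ω}(s,t) = 1∕m²`
# (Track A, DAG node N15 = NE2; FAN-OUT v1.1 §N15 s3 «KING-MODEL RUNG» — its named alternative currency «torus-vs-box twin»; count-neutral)

HONEST FRAMING.  Count-neutral (cell `pub-ymgap`, seat `pub-ymgap-dag-n15-e` g39; `--supports stmt-QuantumFields-27366 --as helper` = K3⁸).
TEMPLATE LITERATURE: C. King, Commun. Math. Phys. **102** (1986) 649–677 [King1986] §4 p.670 l.8–13 (the Ω-propagators as multiple-reflection sums of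
«the operator defined by (2.13) with free boundary conditions», after [Ba 4] = [Balaban1983RegularityDecay] (2.42) p.584 — the INFINITE-lattice image series;
see part Ν-a v1.1's ATTRIBUTION paragraph); [Balaban1984PropagatorsII] (2.37) p.229.  Over part Ν-a (`…KingModelBoxOperator`: `boxOp`, `dblBox`, `torReflS`,
`kingBoxGreen`, the reflection principle `lapF_mulVec_even_dblBox`, `imageColumn_even`) THIS FILE closes the doubled-TORUS (periodized) form of the method of
images for the `A = 0` covariance — a device of these files, equivalent to [Ba 4]'s series by periodization: the image-sum
column `w ↦ Σ_S B⁻¹_{T(2n)}(w, σ_S t)` is `σ`-even and is mapped by `B = c(−Δ)+m²` to `Σ_S δ_{σ_S t}`, of which only the `S = ∅` term lies in the box;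
by the reflection principle it therefore inverts `boxOp` column by column (§1): ★★★ **`boxOp_inv_apply`** — for `c ≥ 0`, `m² > 0` and EVERY box
(v1.1: doc-only erratum of the attribution, decls byte-identical),
`(c(−Δ_free)+m²)⁻¹(s,t) = Σ_{S ⊆ {0,…,d}} (c(−Δ)+m²)⁻¹_{T(2n)}(dblBox s, σ_S(dblBox t))`, `2^{d+1}` values of ONE translation-invariant function on the
doubled torus (`kingBoxGreen_eq_sum_sub`).  §2: the box covariance is symmetric, entrywise STRICTLY POSITIVE (`c > 0`: `2^{d+1}` strictly positive images by
part Ϻ-l's strong maximum principle `lapF_inv_pos`), DOMINATES the torus covariance of the doubled torus (`B⁻¹_{T(2n)}(s,t) ≤ G^{Ω}(s,t)`: free boundary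
conditions only ADD covariance — the `2^{d+1}−1` proper images are `≥ 0`), and satisfies the SUM RULE `Σ_t G^{Ω}(s,t) = 1∕m²` (`(c(−Δ_free)+m²)𝟙 = m²𝟙`:
no mass leaks through a free boundary; on the torus the same sum rule holds for `B⁻¹`).
NOT Bałaban's covariant `G(Ω)` with a background field; NOT a node discharge (N15 is booked through n15-a's knit, untouched); nothing continuum-YM ∕
`ℝ⁴` ∕ OS axioms ∕ Clay.  0 `sorry`, 0 `def`.  PRIOR TREE ART as named in part Ν-a (AllWindowsColdBox's massless signed Dirichlet∕Neumann image sum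
`boxLap_inv_eq`; dag-n15-a's `Sym∘G∘χ°` for Bałaban's vector `Δ_a`); the image device is classical.

WHAT THIS FILE PROVES (kernel).  §1 `lapF_mulVec_imageColumn` (`B·(Σ_S B⁻¹(·, σ_S z)) = Σ_S δ_{σ_S z}`), ★★ `boxOp_mulVec_kingBoxGreen` (`(c(−Δ_free)+m²)G^{Ω}(·,t) = δ_t`),
★★ `boxOp_mul_greenMatrix`, `isUnit_boxOp`, ★★★ **`boxOp_inv_apply`** (THE MULTIPLE REFLECTION REPRESENTATION), `boxOp_inv_eq_kingBoxGreen`, `kingBoxGreen_eq_sum_sub`.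
§2 `image_symm`, `kingBoxGreen_symm`, `kingBoxGreen_nonneg`, ★ `kingBoxGreen_pos`, ★ `lapF_inv_dblBox_le_kingBoxGreen`, ★ `sum_kingBoxGreen_eq`.

HONEST SCOPE.  `m² > 0` and `c ≥ 0` (invertibility of `B` on the doubled torus; `c > 0` for strict positivity); any `d`, any sides `n_μ ≥ 1`.  The
timeslice ∕ mass-gap reading and the transport of torus decay to the box are the sequels Ν-b ∕ Ν-c.  King's `A = 0` scalar model only; N15 untouched;
counts unmoved.  Locators: [King1986] §4 p.670, (4.4) p.670, (2.17) p.653; [Balaban1984PropagatorsII] (2.37) p.229 (SHAPE).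
-/

noncomputable section

open scoped BigOperators symmDiff
open Finset Matrix

namespace Summit.QuantumFields.YangMills.BalabanUVNodes.N15KingModelRung.TorusSpectral

open Literature.MathematicalPhysics.QuantumFieldTheory.Balaban1983to89.B5Prop11Plancherel (Tor unitVec)
open Literature.MathematicalPhysics.QuantumFieldTheory.King1986.Torus
open Summit.QuantumFields.YangMills.BalabanUVNodes.N15.TwoGrid (torRefl torRefl_torRefl torRefl_apply_same torRefl_apply_ne torRefl_injective
  torRefl_bijective sum_torRefl)
open Summit.QuantumFields.YangMills.BalabanUVNodes.N15KingModelRung.Curved (lapF_inv_torRefl)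
open Summit.QuantumFields.YangMills.BalabanUVNodes.N15KingModelRung.ProperTime (lapF_inv_nonneg lapF_inv_pos isUnit_lapF)

variable {d : ℕ}

/-! ## §1 The method of images: `(c(−Δ_free)+m²)⁻¹ = Σ_S B⁻¹_{T(2n)}(·, σ_S ·)` -/

section Images

variable (n : Fin (d + 1) → ℕ) [hn : ∀ μ, NeZero (n μ)]

/-- `B` applied to the image-sum column: `Σ_S [w = σ_S z]` (each image contributes its own `δ`). [folklore] -/
theorem lapF_mulVec_imageColumn {c m2 : ℝ} (hc : 0 ≤ c) (hm : 0 < m2) (z w : Tor (dblPer n)) :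
    (lapF (dblPer n) c m2 *ᵥ fun w' => ∑ S : Finset (Fin (d + 1)), (lapF (dblPer n) c m2)⁻¹ w' (torReflS (dblPer n) S z)) w
      = ∑ S : Finset (Fin (d + 1)), (if w = torReflS (dblPer n) S z then (1 : ℝ) else 0) := by
  have hU : IsUnit (lapF (dblPer n) c m2).det := (Matrix.isUnit_iff_isUnit_det _).mp (isUnit_lapF (dblPer n) hc hm)
  have hcol : ∀ S : Finset (Fin (d + 1)),
      (lapF (dblPer n) c m2 *ᵥ fun w' => (lapF (dblPer n) c m2)⁻¹ w' (torReflS (dblPer n) S z)) w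
        = if w = torReflS (dblPer n) S z then (1 : ℝ) else 0 := by
    intro S
    have h := congr_fun (congr_fun (Matrix.mul_nonsing_inv (lapF (dblPer n) c m2) hU) w) (torReflS (dblPer n) S z)
    rw [Matrix.mul_apply, Matrix.one_apply] at h
    simpa [Matrix.mulVec, dotProduct] using h
  have hsum : (fun w' => ∑ S : Finset (Fin (d + 1)), (lapF (dblPer n) c m2)⁻¹ w' (torReflS (dblPer n) S z))
      = ∑ S : Finset (Fin (d + 1)), (fun w' => (lapF (dblPer n) c m2)⁻¹ w' (torReflS (dblPer n) S z)) := by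
    funext w'; simp only [Finset.sum_apply]
  rw [hsum, Matrix.mulVec_sum, Finset.sum_apply]
  exact Finset.sum_congr rfl fun S _ => hcol S

/-- ★★ The image sum inverts the free-boundary operator, column by column: `(c(−Δ_free)+m²)·G^{Ω}(·,t) = δ_t` (`c ≥ 0`, `m² > 0`). [cite: King1986, §4 p.670] -/
theorem boxOp_mulVec_kingBoxGreen {c m2 : ℝ} (hc : 0 ≤ c) (hm : 0 < m2) (t : KingBox n) :
    boxOp n c m2 *ᵥ (fun s => kingBoxGreen n c m2 s t) = Pi.single t (1 : ℝ) := by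
  funext s
  set F : Tor (dblPer n) → ℝ := fun w => ∑ S : Finset (Fin (d + 1)), (lapF (dblPer n) c m2)⁻¹ w (torReflS (dblPer n) S (dblBox n t)) with hFdef
  have hF : ∀ (κ : Fin (d + 1)) (w : Tor (dblPer n)), F (torRefl (dblPer n) κ w) = F w := fun κ w => imageColumn_even n c m2 (dblBox n t) κ w
  have hG : (fun s' => kingBoxGreen n c m2 s' t) = fun s' => F (dblBox n s') := rfl
  rw [hG, ← lapF_mulVec_even_dblBox n c m2 F hF s, hFdef, lapF_mulVec_imageColumn n hc hm]
  rw [Finset.sum_eq_single (∅ : Finset (Fin (d + 1)))]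
  · rw [torReflS_empty]
    by_cases hst : s = t
    · subst hst; simp
    · rw [Pi.single_eq_of_ne hst, if_neg (fun h => hst (dblBox_injective n h))]
  · intro S _ hS
    rw [if_neg (dblBox_ne_torReflS n (Finset.nonempty_iff_ne_empty.mpr hS) s t)]
  · intro h; exact absurd (Finset.mem_univ _) h

/-- ★★ `A·G = 1` for the free-boundary operator and the image-sum matrix. [cite: King1986, §4 p.670] -/
theorem boxOp_mul_greenMatrix {c m2 : ℝ} (hc : 0 ≤ c) (hm : 0 < m2) :
    boxOp n c m2 * (Matrix.of fun s t => kingBoxGreen n c m2 s t) = 1 := by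
  ext s t
  have h := congr_fun (boxOp_mulVec_kingBoxGreen n hc hm t) s
  rw [Matrix.mulVec, dotProduct] at h
  rw [Matrix.mul_apply, Matrix.one_apply, ← Pi.single_apply t (1 : ℝ) s, ← h]
  rfl

/-- The free-boundary operator is invertible (`c ≥ 0`, `m² > 0`). [folklore] -/
theorem isUnit_boxOp {c m2 : ℝ} (hc : 0 ≤ c) (hm : 0 < m2) : IsUnit (boxOp n c m2) :=
  IsUnit.of_mul_eq_one _ (boxOp_mul_greenMatrix n hc hm)

/-- ★★★ **THE MULTIPLE REFLECTION REPRESENTATION AT `A = 0`, DOUBLED-TORUS FORM (the method of images in all `d+1` directions)**: for `c ≥ 0`, `m² > 0` and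
every box `Ω = Π_μ{0,…,n_μ−1}` (all `n_μ ≥ 1`), the covariance with Neumann («free») boundary conditions on `Ω` is the torus covariance of the DOUBLED torus
`Π_μ ℤ∕2n_μ` summed over the `2^{d+1}` reflected images: `(c(−Δ_free)+m²)⁻¹(s,t) = Σ_{S ⊆ {0,…,d}} (c(−Δ)+m²)⁻¹_{T(2n)}(dblBox s, σ_S(dblBox t))` — the periodized
form of [Ba 4] (2.42), which King invokes on p.670. [cite: King1986, §4 p.670, (2.13) p.653; Balaban1983RegularityDecay, (2.42) p.584] -/
theorem boxOp_inv_apply {c m2 : ℝ} (hc : 0 ≤ c) (hm : 0 < m2) (s t : KingBox n) :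
    (boxOp n c m2)⁻¹ s t = ∑ S : Finset (Fin (d + 1)), (lapF (dblPer n) c m2)⁻¹ (dblBox n s) (torReflS (dblPer n) S (dblBox n t)) := by
  rw [Matrix.inv_eq_right_inv (boxOp_mul_greenMatrix n hc hm), Matrix.of_apply, kingBoxGreen]

/-- `(c(−Δ_free)+m²)⁻¹ = G^{Ω}` (the name). [cite: King1986, §4 p.670] -/
theorem boxOp_inv_eq_kingBoxGreen {c m2 : ℝ} (hc : 0 ≤ c) (hm : 0 < m2) (s t : KingBox n) : (boxOp n c m2)⁻¹ s t = kingBoxGreen n c m2 s t :=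
  boxOp_inv_apply n hc hm s t

/-- The translation-invariant form: `G^{Ω}(s,t) = Σ_S B⁻¹_{T(2n)}(dblBox s − σ_S(dblBox t), 0)` — `2^{d+1}` values of ONE function on the doubled torus.
[cite: King1986, §4 p.670, (2.17) p.653] -/
theorem kingBoxGreen_eq_sum_sub (c m2 : ℝ) (s t : KingBox n) :
    kingBoxGreen n c m2 s t = ∑ S : Finset (Fin (d + 1)), (lapF (dblPer n) c m2)⁻¹ (dblBox n s - torReflS (dblPer n) S (dblBox n t)) 0 := by
  refine Finset.sum_congr rfl fun S _ => ?_
  rw [← Transl.lapF_inv_transl (dblPer n) c m2 (dblBox n s - torReflS (dblPer n) S (dblBox n t)) 0 (torReflS (dblPer n) S (dblBox n t)),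
    sub_add_cancel, zero_add]

end Images

/-! ## §2 Symmetry, positivity, the direct term, the sum rule -/

section Properties

variable (n : Fin (d + 1) → ℕ) [hn : ∀ μ, NeZero (n μ)]

/-- Each image term is symmetric: `B⁻¹(dblBox s, σ_S dblBox t) = B⁻¹(dblBox t, σ_S dblBox s)` (`σ_S`-invariance + `Bᵀ = B`). [folklore] -/
theorem image_symm (c m2 : ℝ) (S : Finset (Fin (d + 1))) (s t : KingBox n) :
    (lapF (dblPer n) c m2)⁻¹ (dblBox n s) (torReflS (dblPer n) S (dblBox n t))
      = (lapF (dblPer n) c m2)⁻¹ (dblBox n t) (torReflS (dblPer n) S (dblBox n s)) := by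
  rw [← lapF_inv_torReflS (dblPer n) c m2 S (dblBox n s) (torReflS (dblPer n) S (dblBox n t)), torReflS_torReflS, lapF_inv_comm]

/-- The box Green's function is symmetric. [folklore] -/
theorem kingBoxGreen_symm (c m2 : ℝ) (s t : KingBox n) : kingBoxGreen n c m2 t s = kingBoxGreen n c m2 s t := by
  unfold kingBoxGreen
  exact Finset.sum_congr rfl fun S _ => (image_symm n c m2 S s t).symm

/-- `G^{Ω} ≥ 0` entrywise (`c ≥ 0`, `m² > 0`: every image term is `≥ 0` by the maximum principle on the torus). [cite: King1986, (4.4) p.670] -/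
theorem kingBoxGreen_nonneg {c m2 : ℝ} (hc : 0 ≤ c) (hm : 0 < m2) (s t : KingBox n) : 0 ≤ kingBoxGreen n c m2 s t :=
  Finset.sum_nonneg fun _ _ => lapF_inv_nonneg (dblPer n) hc hm _ _

/-- ★ `G^{Ω} > 0` entrywise (`c > 0`, `m² > 0`: the strong maximum principle on the doubled torus, `2^{d+1}` strictly positive images). [cite: King1986, (4.4) p.670] -/
theorem kingBoxGreen_pos {c m2 : ℝ} (hc : 0 < c) (hm : 0 < m2) (s t : KingBox n) : 0 < kingBoxGreen n c m2 s t :=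
  Finset.sum_pos (fun _ _ => lapF_inv_pos (dblPer n) hc hm _ _) Finset.univ_nonempty

/-- ★ **THE DIRECT TERM IS A LOWER BOUND**: `B⁻¹_{T(2n)}(dblBox s, dblBox t) ≤ G^{Ω}(s,t)` — the free-boundary covariance DOMINATES the torus covariance of the
doubled torus (the `2^{d+1} − 1` proper images are `≥ 0`). [cite: King1986, §4 p.670] -/
theorem lapF_inv_dblBox_le_kingBoxGreen {c m2 : ℝ} (hc : 0 ≤ c) (hm : 0 < m2) (s t : KingBox n) :
    (lapF (dblPer n) c m2)⁻¹ (dblBox n s) (dblBox n t) ≤ kingBoxGreen n c m2 s t := by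
  unfold kingBoxGreen
  rw [← Finset.add_sum_erase _ _ (Finset.mem_univ (∅ : Finset (Fin (d + 1)))), torReflS_empty]
  exact le_add_of_nonneg_right (Finset.sum_nonneg fun _ _ => lapF_inv_nonneg (dblPer n) hc hm _ _)

/-- ★ **SUM RULE**: `Σ_t G^{Ω}(s,t) = 1∕m²` for every `s` (free boundary conditions conserve the total mass: `(c(−Δ_free)+m²)𝟙 = m²𝟙`). [cite: King1986, (4.4) p.670] -/
theorem sum_kingBoxGreen_eq {c m2 : ℝ} (hc : 0 ≤ c) (hm : 0 < m2) (s : KingBox n) : ∑ t : KingBox n, kingBoxGreen n c m2 s t = m2⁻¹ := by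
  have hU := isUnit_boxOp n hc hm
  have hdet : IsUnit (boxOp n c m2).det := (Matrix.isUnit_iff_isUnit_det _).mp hU
  -- `𝟙 = A⁻¹(A𝟙) = A⁻¹(m²𝟙)`
  have h1 : (boxOp n c m2)⁻¹ *ᵥ (boxOp n c m2 *ᵥ fun _ => (1 : ℝ)) = fun _ => (1 : ℝ) := by
    rw [Matrix.mulVec_mulVec, Matrix.nonsing_inv_mul _ hdet, Matrix.one_mulVec]
  rw [boxOp_mulVec_const] at h1
  have h2 := congr_fun h1 s
  simp only [Matrix.mulVec, dotProduct, mul_one] at h2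
  have h3 : ∑ t : KingBox n, kingBoxGreen n c m2 s t * m2 = 1 := by
    rw [← h2]
    exact Finset.sum_congr rfl fun t _ => by rw [boxOp_inv_eq_kingBoxGreen n hc hm]
  rw [← Finset.sum_mul] at h3
  field_simp
  linarith [h3]

end Properties

end Summit.QuantumFields.YangMills.BalabanUVNodes.N15KingModelRung.TorusSpectral
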